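import Summits.ResolutionOfSingularities.ResolutionOfSingularities.Theorems.FrobeniusLadderFRationalResolutionTowerStep
import HarnessLib

/-!
# Toric surface programme: the chart of a blow-up presented by an abstract ring; regular opens under an iso locus

Support file for crux stmt-ResolutionOfSingularities-15317 (`FrobeniusLadder.FRationalResolution`), line `redirect`,
lead c4 (toric surface programme for rung 4′: all affine toric surfaces `U(r,a) = Spec k[{m ∈ ℤ² : 0 ≤ m₂, a m₂ ≤ r m₁}]`
over every field are resolved by the Hirzebruch–Jung tower of two-chart monomial blow-ups, glued by c3's
abstract `towerStep`). Two abstract tools used by the step `…ToricResolution.lean`: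

* `chart_openImmersion_of_range` — the chart `D₊(bt)` of `Bl_I Spec R` presented by an abstract ring `T ≅ R[I/b]`
  (c3's `xChart_openImmersion_of_range` for an ARBITRARY ideal, exporting the general preimage formulas
  `iV⁻¹ D₊(ct) = D(t)` whenever `f t · b = c`, and `(iV ≫ π)⁻¹ D(c) = D(t)` whenever `f t = c`);
* `isRegular_opens_of_isIso_morphismRestrict` — an open over which a morphism from a regular scheme restricts
  to an isomorphism is regular (this is what lets the invariant "iso over `D(x) ∪ D(w)`" induct with no
  regularity computation beyond `k[ℕ²]`).

All folklore (Kollár 2007 §2.2; Hartshorne II.7; Stacks 0804, 02OS); no published fact is used.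
-/

-- single-problem summit: the doubled namespace component is forced
set_option linter.dupNamespace false

noncomputable section

namespace Summit.ResolutionOfSingularities.ResolutionOfSingularities.Theorems.FRationalResolution

open CategoryTheory AlgebraicGeometry TopologicalSpace
open Literature.AlgebraicGeometry.Resolution

/-! ## The chart of a blow-up presented by an abstract ring -/

/-- **The `b`-chart of `Bl_I Spec R` presented by a ring `T ≅ R[I/b]`.** Let `b ∈ I ⊆ R` and let
`f : T → R[1/b]` be an injective ring map with range the affine blow-up algebra `R[I/b]`. Then there is an
OPEN IMMERSION `iV : Spec T → Bl_I(Spec R)` with range the chart `D₊(bt)` such that `D₊(ct)` pulls back to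
`D(t)` whenever `f t · b = c` (`c ∈ I`), and `D(c) ⊆ Spec R` pulls back through the blow-down to `D(t)`
whenever `f t = c`. (c3's `xChart_openImmersion_of_range`, for an arbitrary ideal and with the general
preimage formulas exported; `reesChartEquiv : (R[It])_{(bt)} ≅ R[I/b]`, `iV = Spec(e) ≫ chartι`.) [folklore] -/
theorem chart_openImmersion_of_range (R : Type) [CommRing R] (I : Ideal R) (b : R) (hb : b ∈ I)
    (T : Type) [CommRing T] {F : Type} [FunLike F T (Localization.Away b)]
    [RingHomClass F T (Localization.Away b)] (f : F) (hfinj : Function.Injective f)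
    (hfrange : Set.range f = (blowupAlgebra I b : Set (Localization.Away b))) :
    ∃ iV : Spec (CommRingCat.of T) ⟶ affineBlowup I, IsOpenImmersion iV ∧
      Set.range iV = (Proj.basicOpen (reesGrading I) (reesT b hb) : Set (affineBlowup I)) ∧
      (∀ (c : R) (hc : c ∈ I) (t : T), f t * algebraMap R _ b = algebraMap R _ c →
        iV ⁻¹ᵁ Proj.basicOpen (reesGrading I) (reesT c hc) = PrimeSpectrum.basicOpen t) ∧
      (∀ (c : R) (t : T), f t = algebraMap R _ c →
        (iV ≫ affineBlowup.π I) ⁻¹ᵁ (PrimeSpectrum.basicOpen c : (Spec (CommRingCat.of R)).Opens) =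
          PrimeSpectrum.basicOpen t) := by
  -- `ψ : T ≃ R[I/b]`
  have hmem : ∀ r : T, f r ∈ blowupAlgebra I b := fun r => by
    rw [← SetLike.mem_coe, ← hfrange]; exact ⟨r, rfl⟩
  set ψ₀ : T →+* blowupAlgebra I b := (f : T →+* Localization.Away b).codRestrict _ hmem with hψ₀
  have hψ₀bij : Function.Bijective ψ₀ := by
    refine ⟨fun a₁ a₂ hab => hfinj (congrArg Subtype.val hab), fun w => ?_⟩
    have hw : (w : Localization.Away b) ∈ Set.range f := by rw [hfrange]; exact w.2
    obtain ⟨r, hr⟩ := hw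
    exact ⟨r, Subtype.ext hr⟩
  set ψ := RingEquiv.ofBijective ψ₀ hψ₀bij with hψ
  have hψval : ∀ r : T, ((ψ r : blowupAlgebra I b) : Localization.Away b) = f r := fun r => rfl
  have hunit : IsUnit (algebraMap R (Localization.Away b) b) := IsLocalization.Away.algebraMap_isUnit b
  set e : HomogeneousLocalization.Away (reesGrading I) (reesT b hb) ≃+* T :=
    (reesChartEquiv (I := I) b hb).trans ψ.symm with he
  -- transition elements: `c/1 = (ct/bt) · (b/1)` in the chart ring
  have htrans : ∀ (c : R) (hc : c ∈ I) (t : T),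
      f t * algebraMap R (Localization.Away b) b = algebraMap R (Localization.Away b) c →
      e (HomogeneousLocalization.Away.isLocalizationElem (reesT_mem b hb) (reesT_mem c hc)) = t := by
    intro c hc t hφ
    apply ψ.injective
    rw [he, RingEquiv.trans_apply, RingEquiv.apply_symm_apply]
    apply Subtype.ext
    rw [hψval]
    refine (hunit.mul_left_inj).mp ?_
    rw [hφ]
    have h := congrArg (fun w => ((reesChartEquiv (I := I) b hb w : blowupAlgebra I b) :
      Localization.Away b)) (reesChartBase_eq_isLocalizationElem_mul b hb c hc)
    simp only [map_mul, reesChartEquiv_reesChartBase, Subalgebra.coe_mul,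
      Subalgebra.coe_algebraMap] at h
    exact h.symm
  have hbase : ∀ (c : R) (t : T), f t = algebraMap R (Localization.Away b) c →
      e (reesChartBase (I := I) b hb c) = t := by
    intro c t hφ
    apply ψ.injective
    rw [he, RingEquiv.trans_apply, RingEquiv.apply_symm_apply, reesChartEquiv_reesChartBase]
    apply Subtype.ext
    rw [hψval, hφ, Subalgebra.coe_algebraMap]
  -- scheme level: `iV = Spec(e) ≫ chartι`
  have hpre : ∀ (c : R) (hc : c ∈ I) (t : T),
      e (HomogeneousLocalization.Away.isLocalizationElem (reesT_mem b hb) (reesT_mem c hc)) = t →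
      (Spec.map e.toCommRingCatIso.hom ≫ affineBlowup.chartι (I := I) b hb) ⁻¹ᵁ
          Proj.basicOpen (reesGrading I) (reesT c hc) = PrimeSpectrum.basicOpen t := by
    intro c hc t hec
    rw [Scheme.Hom.comp_preimage, affineBlowup.chartι,
      Proj.awayι_preimage_basicOpen _ (reesT_mem b hb) one_pos (reesT_mem c hc) one_pos,
      RingEquiv.toCommRingCatIso_hom, specMap_preimage_basicOpen]
    exact congrArg _ (by simpa using hec)
  have hVπ : (Spec.map e.toCommRingCatIso.hom ≫ affineBlowup.chartι (I := I) b hb) ≫ affineBlowup.π I =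
      Spec.map (CommRingCat.ofHom ((e : _ →+* T).comp (reesChartBase b hb))) := by
    rw [Category.assoc, affineBlowup.chartι_π, ← Spec.map_comp, RingEquiv.toCommRingCatIso_hom]
    rfl
  refine ⟨Spec.map e.toCommRingCatIso.hom ≫ affineBlowup.chartι (I := I) b hb, ?_, ?_, ?_, ?_⟩
  · infer_instance
  · rw [← Scheme.Hom.coe_opensRange, Scheme.Hom.opensRange_comp_of_isIso, chartι_opensRange_eq]
  · intro c hc t hφ
    exact hpre c hc t (htrans c hc t hφ)
  · intro c t hφ
    rw [hVπ, specMap_preimage_basicOpen]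
    exact congrArg _ (by simpa using hbase c t hφ)

/-- An open over which a morphism from a REGULAR scheme restricts to an isomorphism is itself a regular
scheme (its stalks are those of the source at the preimage points). [folklore] -/
theorem isRegular_opens_of_isIso_morphismRestrict {Y V : Scheme.{0}} (ρ : Y ⟶ V) (U : V.Opens)
    (hiso : IsIso (ρ ∣_ U)) (hY : Scheme.IsRegular Y) : Scheme.IsRegular (U : Scheme.{0}) := by
  haveI := hiso
  exact Scheme.IsRegular.of_iso (ρ ∣_ U) (isRegular_opens_of_stalk (ρ ⁻¹ᵁ U) fun y _ => hY y)

end Summit.ResolutionOfSingularities.ResolutionOfSingularities.Theorems.FRationalResolution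

end
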